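import Literature.NumberTheory.QuadraticFields.ReducedIdealsPerClass
import Literature.NumberTheory.QuadraticFields.RealQuadraticFundamentalUnitCycle
import Literature.NumberTheory.QuadraticFields.RealQuadraticOddNarrowClassNumber
import Literature.NumberTheory.QuadraticFields.RealQuadraticPrincipalCycleNorms
import HarnessLib

/-!
# The class number of a real quadratic field is at most the number of cycles of reduced ideals —
# a kernel-checkable enumeration certificate; `h(ℚ(√214037)) = 2`

Topic `NumberTheory/QuadraticFields`, namespace `Literature.NumberTheory.QuadraticFields` (sub-namespace `QuadIrr` for the
certificate, `Quadratic` for the field side); continues `ReducedIdealsPerClass.lean` (every ideal class of a real quadratic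
field `K`, `d_K = D`, contains the ideal `𝔞(x) = (Q/2, ω − (t − P)/2)` of a REDUCED IDEAL-SHAPED quotient
`x = (P + √D)/Q` — `exists_isReduced_mk0_eq` — and the class is constant along the continued fraction cycle of `x` —
`mk0_span_fa_iterate`; Jacobson–Williams, *Solving the Pell Equation*, §5.3, Thm. 5.18), `ReducedIdealCycleOfClass.lean`
(`IsReduced.pair_spec`: the integer inequalities of a reduced pair `(a, b) = (Q/2, P)`, op. cit. (3.32)) and
`RealQuadraticFundamentalUnitCycle.lean` (the computable step `QuadIrr.cstep`). Everything here is PROVED; the three `def`s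
are computable `Bool`/`ℕ` plumbing for the certificate.

* `QuadIrr.creach s R n x` — within `n` computable steps from `x` one meets a member of the list `R`;
  `QuadIrr.pairOK D a b` — the reduced-pair inequalities `a, b ≥ 1`, `b² < D < (2a+b)²`, `4a ∣ D − b²`,
  `2a ≤ b ∨ (2a − b)² < D`; **`QuadIrr.cycleEnumCert D s n R`** — `s = ⌊√D⌋` (`s² < D < (s+1)²`), every `r ∈ R` has
  `Q > 0` even, and EVERY pair `(a, b)` with `1 ≤ b ≤ s`, `⌈(s+1−b)/2⌉ ≤ a ≤ ⌈(s+1−b)/2⌉ + b` passing `pairOK` reaches `R`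
  within `n` steps from `(b + √D)/2a` (the ranges contain every reduced pair: `2a + b > √D > s` and `|2a − b| < √D < s + 1`);
* `QuadIrr.exists_mem_iterate_eq_of_cycleEnumCert` — soundness: every reduced ideal-shaped `x` has `step^[k] x ∈ R` for
  some `k ≤ n`;
* **`Quadratic.classNumber_le_of_cycleEnumCert`**: `[K:ℚ] = 2 → d_K = D → cycleEnumCert D s n R = true → h_K ≤ |R|`
  (the class of `C` is the class of `𝔞(x)`, `x` reduced ideal-shaped, `= 𝔞(step^k x) = 𝔞(r)`, `r ∈ R`; so
  `r ↦ [𝔞(r)]` is onto). With `|R| = ` the number of cycles this is the sharp bound (op. cit. Thm. 5.18: the cycles are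
  in bijection with the classes; only `≤` is proved here);
* **`Quadratic.classNumber_eq_two_of_discr_eq_214037`** — `h(ℚ(√214037)) = 2`: the `64` reduced ideals of
  `D = 214037 = 193·1109` form TWO cycles of length `32` (representatives `(89 + √D)/454` and `(111 + √D)/422`, the latter
  the principal cycle), so `h ≤ 2`; and `h` is EVEN by Lemmermeyer's parity criterion
  (`odd_classNumber_iff_card_primeFactors_discr_of_isTotallyReal`: two prime factors, both `≡ 1 (mod 4)`);
  `classNumber_mul_regulator_of_discr_eq_214037`: `h_K R_K = 2 log ((3753351696386 + 8112875904√214037)/2)`.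
  Sanity values of the certificate (not landed as theorems): one cycle at `D = 9173, 225077` (`h = 1`), four at `1365`
  (`h = 4`, `RealQuadraticClassNumber1365.lean`).

* Rev 2 (append): **`Quadratic.classNumber_eq_three_of_discr_eq_170957`** — `h(ℚ(√170957)) = 3`: the `53` reduced
  ideals of the prime discriminant `170957` form THREE cycles (lengths `21, 21, 11`), so `h ≤ 3`; `h` is odd (one prime
  factor); and `h ≠ 1` because the split prime `47` is absent from the principal cycle
  (`RealQuadraticPrincipalCycleNorms.classNumber_ne_one_of_discr_eq_170957`); `classNumber_mul_regulator_of_discr_eq_170957`.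

First consumer: the landau-siegel rescue bed (`Zhang2022/RepairBedClassNumberFormulaReal.lean`: `L(1, χ₂₁₄₀₃₇)`, the rung
`D_47^+ = D_53^+ = D_59^+` of the least-all-inert ladder). Not here: the converse inequality (distinct cycles give distinct
classes), `h(74093) = 5`, `h(24653) = 4`.

## References

* [JacobsonWilliams2008] M. J. Jacobson, Jr., H. C. Williams, *Solving the Pell Equation*, CMS Books in Mathematics,
  Springer (2009), §3.3 (3.32), §5.1 Thm. 5.9, §5.3 Thm. 5.18.
* [Cohen1993] H. Cohen, *A Course in Computational Algebraic Number Theory*, GTM 138, §5.6–§5.7 (reduced ideals and their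
  cycles in real quadratic fields; the class number as the number of cycles).
* [Lemmermeyer2021] F. Lemmermeyer, *Quadratic Number Fields* (2021), §9.2 Cor. 9.11.
-/

noncomputable section

open Module NumberField

namespace Literature.NumberTheory.QuadraticFields

namespace QuadIrr

variable {D : ℕ}

/-! ### The certificate -/

/-- `creach s R n x`: iterating the computable step at most `n` times from `x` one meets a member of `R`.
[cite: JacobsonWilliams2008, §5.3 Thm. 5.18 (walking a cycle of reduced ideals)] -/
def creach (s : ℕ) (R : List (QuadIrr D)) : ℕ → QuadIrr D → Bool
  | 0, x => R.contains x
  | n + 1, x => R.contains x || creach s R n (cstep s x)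

/-- The reduced-pair test for `(a, b)` (the ideal `[a, (b + √D)/2]`): `a, b ≥ 1`, `b² < D`, `4a ∣ D − b²`, `D < (2a + b)²`,
`2a ≤ b ∨ (2a − b)² < D`. [cite: JacobsonWilliams2008, §3.3 (3.32)] -/
def pairOK (D a b : ℕ) : Bool :=
  decide (0 < a) && decide (0 < b) && decide (b * b < D) && decide ((D - b * b) % (4 * a) = 0) &&
    decide (D < (2 * a + b) * (2 * a + b)) && (decide (2 * a ≤ b) || decide ((2 * a - b) * (2 * a - b) < D))

/-- **The cycle-enumeration certificate**: `s² < D < (s+1)²`; every `r ∈ R` has `Q > 0` even; and every pair `(a, b)`,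
`1 ≤ b ≤ s`, `(s + 2 − b)/2 ≤ a < (s + 2 − b)/2 + (b + 1)`, with `4 ∣ D − b²` and `pairOK D a b` reaches `R` within `n`
computable steps from the quotient `(b, 2a)`. [cite: JacobsonWilliams2008, §5.3 Thm. 5.18] -/
def cycleEnumCert (D s n : ℕ) (R : List (QuadIrr D)) : Bool :=
  decide (s * s < D) && decide (D < (s + 1) * (s + 1)) &&
    R.all (fun r => decide (0 < r.Q) && decide (2 ∣ r.Q)) &&
    (List.range' 1 s).all fun b => !decide ((D - b * b) % 4 = 0) ||
      (List.range' ((s + 2 - b) / 2) (b + 1)).all fun a =>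
        !decide ((D - b * b) % (4 * a) = 0) || !pairOK D a b || creach s R n ⟨(b : ℤ), 2 * (a : ℤ)⟩

/-! ### Soundness -/

/-- `creach` finds a member of `R` on the computable orbit. [cite: JacobsonWilliams2008, §5.3 Thm. 5.18] -/
theorem exists_of_creach {s : ℕ} {R : List (QuadIrr D)} :
    ∀ {n : ℕ} {x : QuadIrr D}, creach s R n x = true → ∃ r ∈ R, ∃ k ≤ n, (cstep s)^[k] x = r
  | 0, x, h => by
    simp only [creach, List.contains_iff_mem] at h
    exact ⟨x, h, 0, le_rfl, rfl⟩
  | n + 1, x, h => by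
    simp only [creach, Bool.or_eq_true, List.contains_iff_mem] at h
    rcases h with h | h
    · exact ⟨x, h, 0, Nat.zero_le _, rfl⟩
    · obtain ⟨r, hr, k, hk, hkr⟩ := exists_of_creach h
      exact ⟨r, hr, k + 1, by omega, by rw [Function.iterate_succ_apply]; exact hkr⟩

/-- **Soundness of the enumeration certificate**: every reduced ideal-shaped quotient reaches `R` along its cycle.
[cite: JacobsonWilliams2008, §3.3 (3.32) with §5.3 Thm. 5.18] -/
theorem exists_mem_iterate_eq_of_cycleEnumCert {D s n : ℕ} {R : List (QuadIrr D)} (h : cycleEnumCert D s n R = true)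
    {x : QuadIrr D} (hx : x.IsReduced) (hs : x.IsIdealShaped) :
    ∃ r ∈ R, ∃ k ≤ n, step^[k] x = r := by
  simp only [cycleEnumCert, Bool.and_eq_true, decide_eq_true_eq, List.all_eq_true, Bool.or_eq_true,
    Bool.not_eq_true', decide_eq_false_iff_not] at h
  obtain ⟨⟨⟨hs1, hs2⟩, -⟩, hall⟩ := h
  have hsq : s = Nat.sqrt D := Nat.eq_sqrt.mpr ⟨hs1.le, hs2⟩
  have hD : ¬ IsSquare D := fun ⟨r, hr⟩ => Nat.not_exists_sq hs1 hs2 ⟨r, hr.symm⟩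
  obtain ⟨ha0, hb0, hbD, hdvd, hlt, hor⟩ := hx.pair_spec hs
  obtain ⟨hfa, hP⟩ := hx.pair_cast hs
  set a := (fa x).toNat with ha
  set b := x.P.toNat with hb
  -- `b ≤ s` and the range of `a`
  have hbs : b ≤ s := by
    by_contra hlt'
    have : (s + 1) * (s + 1) ≤ b * b := Nat.mul_self_le_mul_self (by omega)
    have : b * b < D := by rw [← sq]; exact hbD
    omega
  have h2ab : s + 1 ≤ 2 * a + b := by
    by_contra hlt'
    have : (2 * a + b) * (2 * a + b) ≤ s * s := Nat.mul_self_le_mul_self (by omega)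
    have : D < (2 * a + b) * (2 * a + b) := by rw [← sq]; exact hlt
    omega
  have h2ab' : 2 * a ≤ s + b := by
    rcases hor with hle | hlt2
    · omega
    · by_contra hlt'
      have : (s + 1) * (s + 1) ≤ (2 * a - b) * (2 * a - b) := Nat.mul_self_le_mul_self (by omega)
      have : (2 * a - b) * (2 * a - b) < D := by rw [← sq]; exact hlt2
      omega
  have hbmem : b ∈ List.range' 1 s := by rw [List.mem_range'_1]; omega
  have hamem : a ∈ List.range' ((s + 2 - b) / 2) (b + 1) := by rw [List.mem_range'_1]; omega
  have hdvd' : 4 * a ∣ D - b * b := by rw [← sq]; exact hdvd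
  have h4 : (D - b * b) % 4 = 0 := Nat.mod_eq_zero_of_dvd (dvd_trans ⟨a, rfl⟩ hdvd')
  have h4a : (D - b * b) % (4 * a) = 0 := Nat.mod_eq_zero_of_dvd hdvd'
  have hok : pairOK D a b = true := by
    simp only [pairOK, Bool.and_eq_true, decide_eq_true_eq, Bool.or_eq_true]
    refine ⟨⟨⟨⟨⟨ha0, hb0⟩, by rw [← sq]; exact hbD⟩, h4a⟩, by rw [← sq]; exact hlt⟩, ?_⟩
    rcases hor with hle | hlt2
    · exact Or.inl hle
    · exact Or.inr (by rw [← sq]; exact hlt2)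
  rcases hall b hbmem with h4' | hreach
  · exact absurd h4 h4'
  rcases hreach a hamem with (h4a' | hok') | hreach
  · exact absurd h4a h4a'
  · rw [hok] at hok'; exact absurd hok' (by decide)
  -- the quotient `(b, 2a)` is `x`
  have hxeq : (⟨(b : ℤ), 2 * (a : ℤ)⟩ : QuadIrr D) = x := by
    refine QuadIrr.ext ?_ ?_
    · exact hP
    · show 2 * (a : ℤ) = x.Q
      rw [Q_eq_two_mul_fa hs, ← hfa]
  rw [hxeq] at hreach
  obtain ⟨r, hr, k, hk, hkr⟩ := exists_of_creach hreach
  exact ⟨r, hr, k, hk, by rw [iterate_step_eq_iterate_cstep hD hsq hx k]; exact hkr⟩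

/-- The members of a certified `R` have `Q > 0` even, and `D` is not a square (unpacking the certificate).
[cite: JacobsonWilliams2008, §5.3 Thm. 5.18] -/
private theorem pos_even_of_cycleEnumCert {D s n : ℕ} {R : List (QuadIrr D)} (h : cycleEnumCert D s n R = true) :
    ¬ IsSquare D ∧ ∀ r ∈ R, 0 < r.Q ∧ 2 ∣ r.Q := by
  simp only [cycleEnumCert, Bool.and_eq_true, decide_eq_true_eq, List.all_eq_true] at h
  obtain ⟨⟨⟨hs1, hs2⟩, hR⟩, -⟩ := h
  exact ⟨fun ⟨r, hr⟩ => Nat.not_exists_sq hs1 hs2 ⟨r, hr.symm⟩, hR⟩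

end QuadIrr

/-! ### The class number bound -/

namespace Quadratic

open QuadIrr
open scoped nonZeroDivisors

section Bound

variable {K : Type*} [Field K] [NumberField K]

/-- **`h_K ≤` the number of certified cycle representatives.** If `[K:ℚ] = 2`, `d_K = D` and `cycleEnumCert D s n R`
holds, then `classNumber K ≤ R.length`: every class is `[𝔞(x)]` for a reduced ideal-shaped `x`
(`exists_isReduced_mk0_eq`), `[𝔞(step^k x)] = [𝔞(x)]` (`mk0_span_fa_iterate`), and `step^k x ∈ R` for some `k`.
[cite: JacobsonWilliams2008, §5.3 Thm. 5.18] -/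
theorem classNumber_le_of_cycleEnumCert (h2 : finrank ℚ K = 2) {D s n : ℕ} {R : List (QuadIrr D)}
    (hdisc : NumberField.discr K = D) (hcert : cycleEnumCert D s n R = true) :
    NumberField.classNumber K ≤ R.length := by
  classical
  obtain ⟨hD, hR⟩ := pos_even_of_cycleEnumCert hcert
  obtain ⟨b, hb⟩ := exists_basis_zero_eq_one (K := K) h2
  set m : ℤ := b.repr (b 1 * b 1) 0 with hm
  set t : ℤ := b.repr (b 1 * b 1) 1 with ht
  have hω : b 1 * b 1 = (m : 𝓞 K) + (t : 𝓞 K) * b 1 := basis_one_mul_self_eq b hb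
  have hDt : (D : ℤ) = t ^ 2 + 4 * m := by rw [← hdisc]; exact discr_eq_sq_add_four_mul b hb
  -- the map `r ↦ [𝔞(r)]` on `R`
  let I : QuadIrr D → Ideal (𝓞 K) := fun r =>
    Ideal.span {((fa r : ℤ) : 𝓞 K), b 1 - (((t - r.P) / 2 : ℤ) : 𝓞 K)}
  have hI : ∀ i : Fin R.length, I (R.get i) ∈ (Ideal (𝓞 K))⁰ := fun i =>
    span_fa_mem_nonZeroDivisors b hb (t := t) (hR _ (List.get_mem R i)).1 (hR _ (List.get_mem R i)).2
  let g : Fin R.length → ClassGroup (𝓞 K) := fun i => ClassGroup.mk0 ⟨I (R.get i), hI i⟩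
  have hg : Function.Surjective g := by
    intro C
    obtain ⟨x, hs, hr, hIx, hC⟩ := exists_isReduced_mk0_eq b hb hω hDt hD h2 hdisc C
    obtain ⟨r, hrR, k, -, hkr⟩ := exists_mem_iterate_eq_of_cycleEnumCert hcert hr hs
    obtain ⟨i, hi⟩ := List.mem_iff_get.mp hrR
    refine ⟨i, ?_⟩
    have hsk := hs.iterate hD hr k
    have hIk := span_fa_mem_nonZeroDivisors b hb (t := t) hsk.1 hsk.2.1
    have hstep := mk0_span_fa_iterate b hb hω hDt hD k hs hr hIx hIk
    rw [← hC, ← hstep]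
    show ClassGroup.mk0 ⟨I (R.get i), hI i⟩ = _
    congr 1
    exact Subtype.ext (by simp only [I, hi, hkr])
  have hcard := Fintype.card_le_of_surjective g hg
  rw [Fintype.card_fin] at hcard
  exact hcard

end Bound

/-! ### `h(ℚ(√214037)) = 2` -/

section D214037

variable {K : Type} [Field K] [NumberField K]

/-- **`h(ℚ(√214037)) ≤ 2`**: the `64` reduced ideals `[a, (b + √D)/2]` of `D = 214037` lie on TWO cycles of length `32`,
through `(89 + √D)/454` and `(111 + √D)/422` (certificate checked by `decide`). [cite: JacobsonWilliams2008, §5.3 Thm. 5.18] -/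
theorem classNumber_le_two_of_discr_eq_214037 (h2 : finrank ℚ K = 2) (hd : NumberField.discr K = 214037) :
    NumberField.classNumber K ≤ 2 :=
  classNumber_le_of_cycleEnumCert h2 (D := 214037) (s := 462) (n := 32) (R := [⟨89, 454⟩, ⟨111, 422⟩])
    (by exact_mod_cast hd) (by decide +kernel)

/-- **`h(ℚ(√214037))` is even**: `214037 = 193·1109` has exactly two prime factors, both `≡ 1 (mod 4)`
(Lemmermeyer's Cor. 9.11: `h` odd iff `d` has one prime factor, or two with one of them `≡ 3 (mod 4)`).
[cite: Lemmermeyer2021, §9.2 Cor. 9.11] -/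
theorem even_classNumber_of_discr_eq_214037 (h2 : finrank ℚ K = 2) (hd : NumberField.discr K = 214037) :
    Even (NumberField.classNumber K) := by
  have hdpos : 0 < NumberField.discr K := by rw [hd]; norm_num
  haveI : IsTotallyReal K :=
    NumberField.nrComplexPlaces_eq_zero_iff.mp (nrRealPlaces_eq_two_and_nrComplexPlaces_eq_zero h2 hdpos).2
  rw [← Nat.not_odd_iff_even, odd_classNumber_iff_card_primeFactors_discr_of_isTotallyReal h2, hd]
  have h193 : Nat.Prime 193 := by norm_num
  have h1109 : Nat.Prime 1109 := by norm_num
  have hpf : (214037 : ℤ).natAbs.primeFactors = {193, 1109} := by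
    rw [show (214037 : ℤ).natAbs = 193 * 1109 by norm_num, Nat.primeFactors_mul h193.ne_zero h1109.ne_zero,
      h193.primeFactors, h1109.primeFactors, ← Finset.insert_eq]
  rw [hpf, Finset.card_pair (by norm_num)]
  rintro (h | ⟨-, q, hq, hq3, hqd⟩)
  · exact absurd h (by norm_num)
  · have hqd' : q ∣ 193 * 1109 := by exact_mod_cast hqd
    rcases (Nat.Prime.dvd_mul hq).mp hqd' with h | h
    · rw [(Nat.prime_dvd_prime_iff_eq hq h193).mp h] at hq3; norm_num at hq3
    · rw [(Nat.prime_dvd_prime_iff_eq hq h1109).mp h] at hq3; norm_num at hq3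

/-- **`h(ℚ(√214037)) = 2`** (`214037 = 193·1109`, the least positive fundamental discriminant with all primes `≤ 47`
inert — Lehmer–Lehmer–Shanks' `D_47^+`, also `D_53^+ = D_59^+`): two cycles of reduced ideals, and `h` even.
[cite: JacobsonWilliams2008, §5.3 Thm. 5.18] -/
theorem classNumber_eq_two_of_discr_eq_214037 (h2 : finrank ℚ K = 2) (hd : NumberField.discr K = 214037) :
    NumberField.classNumber K = 2 := by
  have hle := classNumber_le_two_of_discr_eq_214037 h2 hd
  obtain ⟨c, hc⟩ := even_classNumber_of_discr_eq_214037 h2 hd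
  have hpos : 0 < NumberField.classNumber K := Fintype.card_pos
  omega

/-- `d_K = 214037`: `h_K · R_K = 2 log ((3753351696386 + 8112875904√214037)/2)` (`= 57.90734…`).
[cite: JacobsonWilliams2008, §5.3 (5.33)–(5.34)] -/
theorem classNumber_mul_regulator_of_discr_eq_214037 (h2 : finrank ℚ K = 2) (hd : NumberField.discr K = 214037) :
    (NumberField.classNumber K : ℝ) * Units.regulator K =
      2 * Real.log ((3753351696386 + 8112875904 * Real.sqrt 214037) / 2) := by
  rw [classNumber_eq_two_of_discr_eq_214037 h2 hd, regulator_of_discr_eq_214037 h2 hd, Nat.cast_ofNat]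

end D214037

/-! ### Rev 2 (append): `h(ℚ(√170957)) = 3` — three cycles (`≤ 3`), a prime discriminant (odd), and the split prime
`47` absent from the principal cycle (`≠ 1`, `RealQuadraticPrincipalCycleNorms.classNumber_ne_one_of_discr_eq_170957`) -/

section D170957

variable {K : Type} [Field K] [NumberField K]

/-- **`h(ℚ(√170957)) ≤ 3`**: the `53` reduced ideals of `D = 170957` lie on THREE cycles (lengths `21, 21, 11`) through
`(123 + √D)/326`, `(123 + √D)/478` and `(243 + √D)/202` (the last one principal). [cite: JacobsonWilliams2008, §5.3 Thm. 5.18] -/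
theorem classNumber_le_three_of_discr_eq_170957 (h2 : finrank ℚ K = 2) (hd : NumberField.discr K = 170957) :
    NumberField.classNumber K ≤ 3 :=
  classNumber_le_of_cycleEnumCert h2 (D := 170957) (s := 413) (n := 21)
    (R := [⟨123, 326⟩, ⟨123, 478⟩, ⟨243, 202⟩]) (by exact_mod_cast hd) (by decide +kernel)

/-- **`h(ℚ(√170957))` is odd**: `170957` is prime (Lemmermeyer's Cor. 9.11, one prime factor).
[cite: Lemmermeyer2021, §9.2 Cor. 9.11] -/
theorem odd_classNumber_of_discr_eq_170957 (h2 : finrank ℚ K = 2) (hd : NumberField.discr K = 170957) :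
    Odd (NumberField.classNumber K) := by
  have hdpos : 0 < NumberField.discr K := by rw [hd]; norm_num
  haveI : IsTotallyReal K :=
    NumberField.nrComplexPlaces_eq_zero_iff.mp (nrRealPlaces_eq_two_and_nrComplexPlaces_eq_zero h2 hdpos).2
  rw [odd_classNumber_iff_card_primeFactors_discr_of_isTotallyReal h2, hd]
  left
  have hp : Nat.Prime 170957 := by norm_num
  rw [show (170957 : ℤ).natAbs = 170957 from rfl, hp.primeFactors, Finset.card_singleton]

/-- **`h(ℚ(√170957)) = 3`** (`170957` prime, the least positive fundamental discriminant with all primes `≤ 43` inert —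
Lehmer–Lehmer–Shanks' `D_43^+`): `h ≤ 3` (three cycles), `h` odd, `h ≠ 1` (`(47, ω − 11)` is not principal).
[cite: JacobsonWilliams2008, §5.3 Thm. 5.18] -/
theorem classNumber_eq_three_of_discr_eq_170957 (h2 : finrank ℚ K = 2) (hd : NumberField.discr K = 170957) :
    NumberField.classNumber K = 3 := by
  have hle := classNumber_le_three_of_discr_eq_170957 h2 hd
  obtain ⟨c, hc⟩ := odd_classNumber_of_discr_eq_170957 h2 hd
  have hne := classNumber_ne_one_of_discr_eq_170957 h2 hd
  omega

/-- `d_K = 170957`: `h_K · R_K = 3 log ((22729657 + 54973√170957)/2)` (`= 50.81754…`).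
[cite: JacobsonWilliams2008, §5.3 (5.33)–(5.34)] -/
theorem classNumber_mul_regulator_of_discr_eq_170957 (h2 : finrank ℚ K = 2) (hd : NumberField.discr K = 170957) :
    (NumberField.classNumber K : ℝ) * Units.regulator K =
      3 * Real.log ((22729657 + 54973 * Real.sqrt 170957) / 2) := by
  rw [classNumber_eq_three_of_discr_eq_170957 h2 hd, regulator_of_discr_eq_170957 h2 hd, Nat.cast_ofNat]

end D170957

end Quadratic

end Literature.NumberTheory.QuadraticFields

end
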